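import Literature.Algebra.EuclideanLattices.Problems
import Literature.Algebra.EuclideanLattices.ARVerifierAlgebra
import Mathlib.Data.Nat.Log
import HarnessLib

/-!
# An integer-arithmetic variant of the Aharonov–Regev coNP verifier for `GapCVP`: definitions and soundness

Topic `Algebra/EuclideanLattices` (family `pqc`; serves the decomposition of Aharonov–Regev 2005,
Thm. 1.1, coNP part = the named fact `gapCVP_sqrt_mem_promiseCoNP` of `LatticeGapNPcoNP.lean`, on
which Cor. 1.2, Thm. 1.1 (`LatticeGapCVPNPcoNP.lean`) and the barrier entry
`Literature.Barriers.PneNP.LatticeGapCoNP` all hang).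

## The printed verifier (preprint `lit read paper:doi-10-1109-focs-2004-35`, §6 p. 10)

Witness: `W = (w₁, …, w_N) ⊆ L*`; accept iff (a) `f_W(v) = N⁻¹ ∑ⱼ cos(2π⟨v, wⱼ⟩) < 1/2`,
(b) `wⱼ ∈ L*`, (c) `λ_max(W Wᵀ) ≤ 3N` (after normalising the instances CLOSE to the lattice to
distance `1/100` and the FAR ones to `> √n`; AR call the far ones YES and the close ones NO — the
reverse of the tree's `GapCVP.yes` (close, `dist ≤ d`) / `GapCVP.no` (far), which is the convention of
the Lean statements below). Soundness §6.1 (p. 11): `v = x + `lattice point, `‖x‖ ≤ 1/100`,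
periodicity of `f_W`, `N⁻¹∑⟨x, wⱼ⟩² ≤ 3/10⁴`, `cos y ≥ 1 − y²/2`. Completeness §6.2: `wⱼ` i.i.d.
from `f̂ = D_{L*}`.

## What is defined here (an all-integer rendering, for a Turing-machine verifier)

On the tree's instances `((B, t), d)` — INTEGER basis (rows), INTEGER target, rational `d = p/q`
(`Problems.lean`) — a certificate `Cert n N` consists of integers only: `(C, D)` with `B C = D·1`
(so `C/D = B⁻¹`; the dual vectors are `wⱼ = C aⱼ / D ∈ L(B)* = B⁻¹ℤⁿ` for integer coordinate
vectors `aⱼ` — test (b) is built into the format), and declared nearest integers `mⱼ` to the phases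
`⟨t, wⱼ⟩ = eⱼ/D`, `eⱼ = ⟨t, C aⱼ⟩ ∈ ℤ`. `Accepts B t d c` (`N = nSamples n = 3000 (n+1)⁴` samples)
checks, in integer arithmetic:

1. `D ≠ 0`, `B C = D · 1`;
2. `|2 εⱼ| ≤ |D|` with `εⱼ = eⱼ − mⱼ D` (so `|εⱼ/D| = ‖⟨t, wⱼ⟩‖_{ℝ/ℤ}`, distance to the nearest integer);
3. test (a''), for (a): `N D² ≤ 50 ∑ⱼ εⱼ²`, i.e. `∑ⱼ ‖⟨t, wⱼ⟩‖²_{ℝ/ℤ} ≥ N/50` — no cosines; the link is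
   `cos 2πθ ≥ 1 − 2π²‖θ‖²` (completeness) and periodicity (soundness);
4. test (c'), for (c): `(100p)^{2k} trace ((G Gᵀ)^k) ≤ (4N (qD)²)^k` with the sample matrix
   `G = [C a₁ ⋯ C a_N]` and `k = 2^m`, `m = powSteps n = ⌊log₂ n⌋ + 1` — i.e.
   `trace ((W Wᵀ)^k)^{1/k} ≤ 4N/(100d)²`; since `λ_max ≤ trace(·^k)^{1/k} ≤ n^{1/k} λ_max < 2 λ_max`
   (`n < 2^m`), this is the eigenvalue test up to a factor `2`, decided by `m` squarings of an
   integer matrix — no eigenvalues.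

Constants: soundness needs `λ_max(W Wᵀ) d² ≤ 4N/10⁴ = N/2500 < N/50`; completeness (sibling file to
come) samples `wⱼ ∼ D_{L*, 1/(100d)}`, for which `E ‖⟨t, wⱼ⟩‖² ≥ (1 − f(t))/(2π²) > 1/20 > 1/50` at
points with `dist(t, L) > 200 √n d` (AR Lemma 3.1, `GaussianLatticeTails.lean`; the phase bound is
`GaussianLatticeMoments.lean`) and `λ_max(W Wᵀ) ≲ (π/8 + 1) N/(100d)² ≤ 2N/(100d)²`
(truncated second moments, `GaussianLatticeMoments.lean`, plus a Frobenius-deviation bound,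
`Probability/Moments/IIDSecondMoment.lean`, `DualGaussianSampling.lean` — this Markov bound is what
forces `N = Θ(n⁴)`), whence `trace ≤ n (2N/(100d)²)^k ≤ (4N/(100d)²)^k`.

## What is proved here

`not_accepts_of_infDist_le` — **soundness** (AR05 §6.1 for this variant): if `dist(t, L(B)) ≤ d`,
`d > 0`, then no certificate is accepted. The closest lattice vector `z B` gives `e = t − z B`,
`‖e‖ ≤ d`; `B C = D·1` gives `⟨z B, C aⱼ⟩ = D ⟨z, aⱼ⟩`, so `eⱼ/D ≡ ⟨e, C aⱼ⟩/D (mod 1)` and, by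
check 2, `εⱼ² ≤ ⟨e, C aⱼ⟩²`; summing, `∑ εⱼ² ≤ eᵀ G Gᵀ e ≤ Λ ‖e‖² ≤ Λ d²` where the trace test gives
the quadratic-form bound `Λ = 4N (qD)²/(100p)²` through the eigenvalue-free inequality
`(eᵀTe)^k ≤ ‖e‖^{2k} trace (T^k)` of `ARVerifierAlgebra.lean`; with `qd = p` this is
`∑ εⱼ² ≤ 4N D²/10⁴`, contradicting check 3. (Nonsingularity of `B` is not even needed.)

## Relation to `GapCVPCoNPWitness.lean` (`FarCert`) — two integer designs for one leaf

`GapCVPCoNPWitness.lean` (landed the same day by the unit proving Cor. 1.2) renders the same printed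
verifier differently: the same `(C, δ, A)` format, test (a) as a COUNT of far phases
(`pⱼ mod |δ|`, no nearest integers), test (c) as a prover-supplied certificate `σ² Q = RᵀR` of
positive semidefiniteness (two integer matrix products for the machine), with soundness proved and
completeness (`FarCert.complete`, which must also construct `(R, σ)`: rational `LDLᵀ`, four squares,
subdeterminant bit bounds) and the machine (`FarCert.verifier_mem_P`) as named facts, and the leaf
already reduced to those two facts. The present design makes the opposite trade: the machine is
heavier (`⌊log₂ n⌋ + 1` squarings of an `n × n` integer matrix, with doubling bit growth), the
completeness lighter (the sampled data `aⱼ = B wⱼ`, `mⱼ`, `C = adj B`, `D = det B` ARE the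
certificate; no factorisation). The analytic and probabilistic bricks (`GaussianLatticeSums/Tails/
Moments.lean`, `IIDSecondMoment.lean`) serve both. Whichever design first acquires BOTH its machine
fact and its completeness discharges `gapCVP_sqrt_mem_promiseCoNP` for all dependants; the other is
then to be marked superseded in its header (librarian). Not here: completeness of this design
(next file), its machine-level fact, the assembly.

## References

* D. Aharonov, O. Regev, *Lattice problems in NP ∩ coNP*, J. ACM 52 (2005) 749–765, §6, §6.1
  (pp. 10–11 of the preprint).
* D. Micciancio, S. Goldwasser, *Complexity of Lattice Problems*, Kluwer 2002, Ch. 1 §1.2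
  (`GapCVP`, integer instances).
-/

noncomputable section

open Matrix Metric Literature.NumberTheory.Sieve.Vinogradov
open scoped Real

namespace Literature.Algebra.EuclideanLattices

namespace ARVerifier

/-! ### Parameters -/

/-- The number `N` of dual samples in a witness for dimension `n`: `N = 3000 (n + 1)⁴`
(Aharonov–Regev take `N = n⁴ ℓ` for the union bound over the grid `L_ℓ`, needed only for CVPP;
for the coNP verifier a single point matters, p. 10 "Remark". The completeness proof of this
variant controls the operator norm of the empirical moment matrix by a SECOND-MOMENT (Markov) bound
on its Frobenius deviation — `DualGaussianSampling.lean`, in place of the printed `ε`-net with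
Chernoff–Hoeffding — whose failure probability is `(3√n)⁴ n² · 4/N = 324 n⁴/N`, hence the quartic
count.) [cite: AharonovRegev2005, §6 (p. 10) — variant] -/
def nSamples (n : ℕ) : ℕ := 3000 * (n + 1) ^ 4

/-- The number `m` of squarings in the trace test: the power is `k = 2^m` with `m = ⌊log₂ n⌋ + 1`,
so that `n < k ≤ 2n` (for `n ≥ 1`) and `m ≥ 1`. [cite: AharonovRegev2005, §6 (p. 10) — variant] -/
def powSteps (n : ℕ) : ℕ := Nat.log 2 n + 1

/-- `n < 2 ^ powSteps n`. [folklore] -/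
theorem lt_two_pow_powSteps (n : ℕ) : n < 2 ^ powSteps n :=
  Nat.lt_pow_succ_log_self one_lt_two n

/-- `1 ≤ powSteps n`. [folklore] -/
theorem one_le_powSteps (n : ℕ) : 1 ≤ powSteps n := Nat.le_add_left 1 _

/-- `0 < nSamples n`. [folklore] -/
theorem nSamples_pos (n : ℕ) : 0 < nSamples n := by
  unfold nSamples; positivity

/-- `3000 ≤ nSamples n` (room for the Chebyshev bound on the distance-to-`ℤ` statistic). [folklore] -/
theorem le_nSamples (n : ℕ) : 3000 ≤ nSamples n := by
  unfold nSamples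
  exact Nat.le_mul_of_pos_right _ (by positivity)

/-- `3000 n⁴ ≤ nSamples n` (room for the Markov bound on the Frobenius deviation). [folklore] -/
theorem pow_four_le_nSamples (n : ℕ) : 3000 * n ^ 4 ≤ nSamples n := by
  unfold nSamples
  exact Nat.mul_le_mul_left _ (Nat.pow_le_pow_left (Nat.le_succ n) 4)

/-- `nSamples n = 3000 (n + 1)⁴` as real numbers. [folklore] -/
theorem cast_nSamples (n : ℕ) : (nSamples n : ℝ) = 3000 * ((n : ℝ) + 1) ^ 4 := by
  unfold nSamples
  push_cast
  ring

-- The parameters are large literals times polynomials; keep them opaque to definitional unfolding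
-- (otherwise `Fin (nSamples n)` invites kernel-level evaluation of `1000 * (n + 1) ^ 2`).
attribute [irreducible] nSamples powSteps

/-! ### Certificates -/

/-- A **certificate** (coNP witness, in the integer format read by the verifier) for an instance
`((B, t), d)` of `GapCVP` in dimension `n` with `N` samples: an integer matrix `C` and an integer
`D` (meant to be `adj B` and `det B`, so that `B⁻¹ = C/D`), `N` integer vectors `a₁, …, a_N ∈ ℤⁿ`
(the coordinates `aⱼ = B wⱼ` of dual vectors `wⱼ = B⁻¹ aⱼ ∈ L(B)*` — Aharonov–Regev's witness
matrix `W`, §6 p. 10, in the basis in which membership in `L*` is automatic), and `N` integers `mⱼ`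
(meant to be nearest integers to `⟨t, wⱼ⟩`). [cite: AharonovRegev2005, §6 (p. 10) — variant] -/
structure Cert (n N : ℕ) where
  /-- Integer matrix with `B C = D · 1` (e.g. the adjugate of `B`). -/
  C : Matrix (Fin n) (Fin n) ℤ
  /-- Nonzero integer with `B C = D · 1` (e.g. `det B`). -/
  D : ℤ
  /-- The integer coordinates `aⱼ` of the dual samples `wⱼ = C aⱼ / D`. -/
  A : Fin N → Fin n → ℤ
  /-- The declared nearest integers `mⱼ` to `⟨t, wⱼ⟩`. -/
  m : Fin N → ℤ

namespace Cert

variable {n N : ℕ} (c : Cert n N)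

/-- The numerator `gⱼ = C aⱼ ∈ ℤⁿ` of the `j`-th dual sample `wⱼ = gⱼ / D`. [folklore] -/
def dualNum (j : Fin N) : Fin n → ℤ := c.C *ᵥ c.A j

/-- The `n × N` integer SAMPLE matrix `G = [g₁ ⋯ g_N]` whose columns are the numerators `gⱼ` (so the
witness matrix is `W = G / D` and the Gram/moment matrix is `G Gᵀ / D²`). [folklore] -/
def sampleMat : Matrix (Fin n) (Fin N) ℤ := Matrix.of fun i j => c.dualNum j i

/-- The numerator `eⱼ = ⟨t, gⱼ⟩ ∈ ℤ` of the phase `⟨t, wⱼ⟩ = eⱼ / D`. [folklore] -/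
def phaseNum (t : Fin n → ℤ) (j : Fin N) : ℤ := t ⬝ᵥ c.dualNum j

/-- The residual `εⱼ = eⱼ - mⱼ D ∈ ℤ`, so that `εⱼ / D = ⟨t, wⱼ⟩ - mⱼ`. [folklore] -/
def residual (t : Fin n → ℤ) (j : Fin N) : ℤ := c.phaseNum t j - c.m j * c.D

/-- Entries of the sample matrix: `G i j = (gⱼ) i`. [folklore] -/
@[simp] theorem sampleMat_apply (i : Fin n) (j : Fin N) : c.sampleMat i j = c.dualNum j i := rfl

end Cert

/-! ### The acceptance predicate -/

/-- **The verifier's acceptance predicate** on an instance `((B, t), d)` of `GapCVP` (integer basis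
`B`, integer target `t`, rational `d = p/q > 0`) and a certificate `c = (C, D, (aⱼ), (mⱼ))` with
`N = nSamples n` samples — five checks in integer arithmetic:

1. `D ≠ 0` and `B C = D · 1` (so `C/D = B⁻¹` and every `wⱼ = C aⱼ / D` lies in `L(B)*`; this
   makes Aharonov–Regev's test (b) `wⱼ ∈ L*` automatic);
2. `|2 εⱼ| ≤ |D|` for every `j` (`mⱼ` is a nearest integer to `⟨t, wⱼ⟩ = eⱼ/D`, so that
   `|εⱼ/D| = ‖⟨t, wⱼ⟩‖_{ℝ/ℤ}`);
3. test (a''), replacing (a) `f_W(t) < 1/2`: `N D² ≤ 50 ∑ⱼ εⱼ²`, i.e. `∑ⱼ ‖⟨t, wⱼ⟩‖²_{ℝ/ℤ} ≥ N/50`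
   (a point far from the lattice has phases far from `ℤ`: `cos(2πθ) ≥ 1 - 2π²‖θ‖²`);
4. test (c'), replacing (c) `λ_max(W Wᵀ) ≤ 3N`: with the sample matrix `G = [g₁ ⋯ g_N]`,
   `k = 2^{powSteps n}`,
   `(100 p)^{2k} trace ((G Gᵀ)^k) ≤ (4 N (q D)²)^k`, i.e. `trace ((W Wᵀ)^k)^{1/k} ≤ 4N/(100 d)²` for
   `W = G/D` — which forces `λ_max(W Wᵀ) ≤ 4N/(100d)²` (`ARVerifierAlgebra.lean`), the scale
   `1/(100 d)` being Aharonov–Regev's normalisation of NO instances to distance `1/100`.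

Soundness and completeness are proved in the sibling files; membership in `P` of the induced
language of pairs (instance code, certificate code) is the machine-level content.
[cite: AharonovRegev2005, §6 (p. 10), §6.1–6.2 — variant] -/
def Accepts {n : ℕ} (B : Matrix (Fin n) (Fin n) ℤ) (t : Fin n → ℤ) (d : ℚ) (c : Cert n (nSamples n)) : Prop :=
  c.D ≠ 0 ∧ B * c.C = c.D • (1 : Matrix (Fin n) (Fin n) ℤ) ∧
    (∀ j, |2 * c.residual t j| ≤ |c.D|) ∧
    (nSamples n : ℤ) * c.D ^ 2 ≤ 50 * ∑ j, c.residual t j ^ 2 ∧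
    (100 * d.num) ^ (2 * 2 ^ powSteps n) * Matrix.trace ((c.sampleMat * c.sampleMatᵀ) ^ 2 ^ powSteps n) ≤
      (4 * (nSamples n : ℤ) * ((d.den : ℤ) * c.D) ^ 2) ^ 2 ^ powSteps n

variable {n : ℕ}

/-! ### Casting the integer data to `ℝ` -/

/-- Integer vectors cast to real vectors. [folklore] -/
def castVec (v : Fin n → ℤ) : Fin n → ℝ := fun i ↦ (v i : ℝ)

/-- Entries of `castVec`. [folklore] -/
@[simp] theorem castVec_apply (v : Fin n → ℤ) (i : Fin n) : castVec v i = (v i : ℝ) := rfl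

/-- Casting commutes with the dot product. [folklore] -/
theorem castVec_dotProduct (v w : Fin n → ℤ) : castVec v ⬝ᵥ castVec w = ((v ⬝ᵥ w : ℤ) : ℝ) := by
  simp [dotProduct, castVec]

/-- The squared distance of two integer vectors in `ℝⁿ` is the sum of squared coordinate
differences. [folklore] -/
theorem dist_intVecToEuclidean_sq (v w : Fin n → ℤ) :
    dist (intVecToEuclidean n v) (intVecToEuclidean n w) ^ 2 = (castVec v - castVec w) ⬝ᵥ (castVec v - castVec w) := by
  rw [EuclideanSpace.dist_eq, Real.sq_sqrt (Finset.sum_nonneg fun i _ ↦ sq_nonneg _)]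
  simp [dotProduct, Real.dist_eq, sq]

/-- The integer sample matrix cast to `ℝ`. [folklore] -/
def sampleMatR {N : ℕ} (c : Cert n N) : Matrix (Fin n) (Fin N) ℝ := c.sampleMat.map (Int.castRingHom ℝ)

/-- Entries of `sampleMatR`. [folklore] -/
@[simp] theorem sampleMatR_apply {N : ℕ} (c : Cert n N) (i : Fin n) (j : Fin N) :
    sampleMatR c i j = ((c.dualNum j i : ℤ) : ℝ) := rfl

/-- Casting the trace of a power of the integer moment matrix `G Gᵀ`. [folklore] -/
theorem cast_trace_sampleMat_pow {N : ℕ} (c : Cert n N) (k : ℕ) :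
    ((Matrix.trace ((c.sampleMat * c.sampleMatᵀ) ^ k) : ℤ) : ℝ) = Matrix.trace ((sampleMatR c * (sampleMatR c)ᵀ) ^ k) := by
  have h1 : (Int.castRingHom ℝ) (Matrix.trace ((c.sampleMat * c.sampleMatᵀ) ^ k)) =
      Matrix.trace (((c.sampleMat * c.sampleMatᵀ) ^ k).map (Int.castRingHom ℝ)) :=
    AddMonoidHom.map_trace (Int.castRingHom ℝ) _
  rw [eq_intCast] at h1
  rw [h1]
  congr 1
  have h2 : ((c.sampleMat * c.sampleMatᵀ) ^ k).map ⇑(Int.castRingHom ℝ) =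
      (Int.castRingHom ℝ).mapMatrix ((c.sampleMat * c.sampleMatᵀ) ^ k) := rfl
  rw [h2, map_pow, RingHom.mapMatrix_apply, Matrix.map_mul, Matrix.transpose_map]
  rfl

/-! ### Soundness -/

/-- **The key integrality**: if `B C = D · 1` then for every lattice vector `v = z B` and every
certificate column, `⟨v, C a⟩ = D ⟨z, a⟩`; hence `⟨v, wⱼ⟩ ∈ ℤ` for `wⱼ = C aⱼ / D` — the dual
vectors named by a certificate are genuinely in `L(B)*` (Aharonov–Regev's test (b)).
[cite: AharonovRegev2005, §6.1 (p. 11: "since test (b) accepts, f_W is periodic over L") — variant] -/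
theorem vecMul_dotProduct_mulVec_eq {B C : Matrix (Fin n) (Fin n) ℤ} {D : ℤ}
    (hBC : B * C = D • (1 : Matrix (Fin n) (Fin n) ℤ)) (z a : Fin n → ℤ) :
    (z ᵥ* B) ⬝ᵥ (C *ᵥ a) = D * (z ⬝ᵥ a) := by
  rw [← dotProduct_mulVec, mulVec_mulVec, hBC, smul_mulVec, one_mulVec, dotProduct_smul, smul_eq_mul]

/-- **Soundness of the integer-arithmetic Aharonov–Regev verifier**: if the target `t` is within
distance `d` of the lattice `L(B)` (`d > 0` — a YES instance of `GapCVP_γ`), then NO certificate is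
accepted. Printed argument (§6.1): write `t = v + e` with `v ∈ L`, `‖e‖ ≤ d`; since `wⱼ ∈ L*`,
`⟨t, wⱼ⟩ ≡ ⟨e, wⱼ⟩ (mod 1)`, so `‖⟨t, wⱼ⟩‖_{ℝ/ℤ} ≤ |⟨e, wⱼ⟩|` and
`∑ⱼ ‖⟨t, wⱼ⟩‖²_{ℝ/ℤ} ≤ eᵀ W Wᵀ e ≤ λ_max(W Wᵀ) ‖e‖²`; the trace test bounds the quadratic form of
`W Wᵀ` by `4N/(100 d)²` (`dotProduct_mulVec_le_of_trace_pow_le`), giving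
`∑ⱼ ‖⟨t, wⱼ⟩‖² ≤ 4N/10⁴ < N/50`, contradicting test (a''). (Nonsingularity of `B` is not needed:
`B C = D · 1` with `D ≠ 0` is part of what the verifier checks.)
[cite: AharonovRegev2005, §6.1 (Soundness, p. 11) — variant] -/
theorem not_accepts_of_infDist_le {I : LatticeInstance} {t : Fin I.n → ℤ} {d : ℚ} (hd : 0 < d)
    (hdist : infDist (intVecToEuclidean I.n t) (I.lattice : Set (EuclideanSpace ℝ (Fin I.n))) ≤ d)
    (c : Cert I.n (nSamples I.n)) : ¬ Accepts I.basis t d c := by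
  rintro ⟨hD, hBC, hnear, hsum, htr⟩
  -- (1) a closest lattice vector `v = z B`, `‖t - v‖ ≤ d`
  have hclosed : IsClosed (X := EuclideanSpace ℝ (Fin I.n)) I.lattice :=
    @AddSubgroup.isClosed_of_discrete _ _ _ _ _ I.lattice.toAddSubgroup (inferInstanceAs (DiscreteTopology I.lattice))
  obtain ⟨v, hv, hvd⟩ := hclosed.exists_infDist_eq_dist ⟨0, I.lattice.zero_mem⟩ (intVecToEuclidean I.n t)
  obtain ⟨z, rfl⟩ := (I.mem_lattice_iff v).1 hv
  have hdv : dist (intVecToEuclidean I.n t) (I.ofCoeffs z) ≤ d := hvd ▸ hdist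
  -- real data
  set tR : Fin I.n → ℝ := castVec t with htR
  set vR : Fin I.n → ℝ := castVec (z ᵥ* I.basis) with hvR
  set eR : Fin I.n → ℝ := tR - vR with heR
  have hee : eR ⬝ᵥ eR ≤ (d : ℝ) ^ 2 := by
    rw [heR, htR, hvR, ← dist_intVecToEuclidean_sq]
    exact pow_le_pow_left₀ dist_nonneg hdv 2
  have hee0 : 0 ≤ eR ⬝ᵥ eR := by
    simp only [dotProduct, ← sq]; positivity
  have hDR0 : ((c.D : ℤ) : ℝ) ≠ 0 := by exact_mod_cast hD
  set gR : Fin (nSamples I.n) → Fin I.n → ℝ := fun j ↦ castVec (c.dualNum j) with hgR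
  -- (2) phases: `eⱼ/D = ⟨t, wⱼ⟩ = ⟨z, aⱼ⟩ + ⟨e, gⱼ⟩/D`
  have hphase : ∀ j, ((c.phaseNum t j : ℤ) : ℝ) / ((c.D : ℤ) : ℝ) = ((z ⬝ᵥ c.A j : ℤ) : ℝ) + eR ⬝ᵥ gR j / ((c.D : ℤ) : ℝ) := by
    intro j
    have hint : vR ⬝ᵥ gR j = ((c.D : ℤ) : ℝ) * ((z ⬝ᵥ c.A j : ℤ) : ℝ) := by
      show castVec (z ᵥ* I.basis) ⬝ᵥ castVec (c.C *ᵥ c.A j) = _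
      rw [castVec_dotProduct, vecMul_dotProduct_mulVec_eq hBC]
      push_cast
      ring
    have ht : ((c.phaseNum t j : ℤ) : ℝ) = tR ⬝ᵥ gR j := by
      rw [Cert.phaseNum, htR, hgR, castVec_dotProduct]
    rw [ht, show tR = eR + vR by rw [heR]; abel, add_dotProduct, hint]
    field_simp
    ring
  -- (3) residuals: `|εⱼ/D| = ‖⟨t, wⱼ⟩‖_{ℝ/ℤ} ≤ |⟨e, gⱼ⟩/D|`, hence `εⱼ² ≤ ⟨e, gⱼ⟩²`
  have hres : ∀ j, ((c.residual t j : ℤ) : ℝ) ^ 2 ≤ (eR ⬝ᵥ gR j) ^ 2 := by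
    intro j
    have hρ : ((c.residual t j : ℤ) : ℝ) / ((c.D : ℤ) : ℝ) = ((c.phaseNum t j : ℤ) : ℝ) / ((c.D : ℤ) : ℝ) - (c.m j : ℝ) := by
      rw [Cert.residual]
      push_cast
      rw [sub_div, mul_div_cancel_right₀ _ hDR0]
    have hhalf : |((c.phaseNum t j : ℤ) : ℝ) / ((c.D : ℤ) : ℝ) - (c.m j : ℝ)| ≤ 1 / 2 := by
      rw [← hρ, abs_div, div_le_iff₀ (abs_pos.2 hDR0)]
      have h2' : |(2 : ℝ) * ((c.residual t j : ℤ) : ℝ)| ≤ |((c.D : ℤ) : ℝ)| := by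
        have := (Int.cast_le (R := ℝ)).2 (hnear j)
        push_cast at this
        exact this
      rw [abs_mul, abs_two] at h2'
      linarith
    have hdi : |((c.phaseNum t j : ℤ) : ℝ) / ((c.D : ℤ) : ℝ) - (c.m j : ℝ)| = distInt (eR ⬝ᵥ gR j / ((c.D : ℤ) : ℝ)) := by
      rw [abs_sub_intCast_eq_distInt hhalf, hphase, distInt_int_add]
    have hle : |((c.residual t j : ℤ) : ℝ) / ((c.D : ℤ) : ℝ)| ≤ |eR ⬝ᵥ gR j / ((c.D : ℤ) : ℝ)| := by
      rw [hρ, hdi]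
      exact distInt_le_abs _
    rw [abs_div, abs_div, div_le_div_iff_of_pos_right (abs_pos.2 hDR0)] at hle
    exact sq_le_sq.2 hle
  -- (4) `∑ⱼ ⟨e, gⱼ⟩² = eᵀ G Gᵀ e`
  have hquad : ∑ j, (eR ⬝ᵥ gR j) ^ 2 = eR ⬝ᵥ (sampleMatR c * (sampleMatR c)ᵀ) *ᵥ eR := by
    rw [dotProduct_mul_transpose_mulVec]
    refine Finset.sum_congr rfl fun j _ ↦ ?_
    simp only [dotProduct, sampleMatR_apply, hgR, castVec_apply]
  -- (5) the trace test, cast to `ℝ`: `trace ((G Gᵀ)^k) ≤ Λ^k`, `Λ = 4N (qD)²/(100p)²`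
  have hp : 0 < ((d.num : ℤ) : ℝ) := by exact_mod_cast Rat.num_pos.2 hd
  have hq : 0 < ((d.den : ℕ) : ℝ) := by exact_mod_cast d.den_pos
  have hcast : (100 * ((d.num : ℤ) : ℝ)) ^ (2 * 2 ^ powSteps I.n) *
        Matrix.trace ((sampleMatR c * (sampleMatR c)ᵀ) ^ 2 ^ powSteps I.n) ≤
      (4 * (nSamples I.n : ℝ) * (((d.den : ℕ) : ℝ) * ((c.D : ℤ) : ℝ)) ^ 2) ^ 2 ^ powSteps I.n := by
    have h := (Int.cast_le (R := ℝ)).2 htr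
    rw [Int.cast_mul, Int.cast_pow, cast_trace_sampleMat_pow, Int.cast_pow] at h
    push_cast at h
    exact h
  obtain ⟨Λ, hΛ⟩ : ∃ Λ : ℝ,
      Λ = 4 * (nSamples I.n : ℝ) * (((d.den : ℕ) : ℝ) * ((c.D : ℤ) : ℝ)) ^ 2 / (100 * ((d.num : ℤ) : ℝ)) ^ 2 :=
    ⟨_, rfl⟩
  have hΛ0 : 0 ≤ Λ := by subst hΛ; positivity
  have htrR : Matrix.trace ((sampleMatR c * (sampleMatR c)ᵀ) ^ 2 ^ powSteps I.n) ≤ Λ ^ 2 ^ powSteps I.n := by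
    subst hΛ
    rw [div_pow, le_div_iff₀ (by positivity), mul_comm, ← pow_mul]
    exact hcast
  have hform := dotProduct_mulVec_le_of_trace_pow_le (transpose_mul_transpose_self (sampleMatR c))
    (dotProduct_mul_transpose_mulVec_nonneg (sampleMatR c)) (one_le_powSteps I.n) hΛ0 htrR eR
  -- (6) `∑ εⱼ² ≤ eᵀ G Gᵀ e ≤ Λ ‖e‖² ≤ Λ d² = 4 N D²/10⁴`
  have hdq : (d : ℝ) * ((d.den : ℕ) : ℝ) = ((d.num : ℤ) : ℝ) := by exact_mod_cast Rat.mul_den_eq_num d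
  have hΛd : Λ * (d : ℝ) ^ 2 = 4 * (nSamples I.n : ℝ) * ((c.D : ℤ) : ℝ) ^ 2 / 10 ^ 4 := by
    rw [hΛ]
    field_simp
    rw [← hdq]
    ring
  have hsumR : ∑ j, ((c.residual t j : ℤ) : ℝ) ^ 2 ≤ 4 * (nSamples I.n : ℝ) * ((c.D : ℤ) : ℝ) ^ 2 / 10 ^ 4 := by
    calc ∑ j, ((c.residual t j : ℤ) : ℝ) ^ 2 ≤ ∑ j, (eR ⬝ᵥ gR j) ^ 2 := Finset.sum_le_sum fun j _ ↦ hres j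
      _ = eR ⬝ᵥ (sampleMatR c * (sampleMatR c)ᵀ) *ᵥ eR := hquad
      _ ≤ Λ * (eR ⬝ᵥ eR) := hform
      _ ≤ Λ * (d : ℝ) ^ 2 := mul_le_mul_of_nonneg_left hee hΛ0
      _ = 4 * (nSamples I.n : ℝ) * ((c.D : ℤ) : ℝ) ^ 2 / 10 ^ 4 := hΛd
  -- (7) contradiction with test (a''): `N D² ≤ 50 ∑ εⱼ² ≤ N D²/50`
  have hsum' : (nSamples I.n : ℝ) * ((c.D : ℤ) : ℝ) ^ 2 ≤ 50 * ∑ j, ((c.residual t j : ℤ) : ℝ) ^ 2 := by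
    have h := (Int.cast_le (R := ℝ)).2 hsum
    push_cast at h
    exact h
  have hNpos : (0 : ℝ) < nSamples I.n := by exact_mod_cast nSamples_pos I.n
  have hD2 : 0 < ((c.D : ℤ) : ℝ) ^ 2 := by positivity
  have hND := mul_pos hNpos hD2
  have hchain := hsum'.trans (mul_le_mul_of_nonneg_left hsumR (by norm_num))
  nlinarith

end ARVerifier

end Literature.Algebra.EuclideanLattices

end
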